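import Literature.NumberTheory.Transcendental.QuadraticRelationsLogarithmsClifford
import Literature.NumberTheory.Transcendental.QuadraticRelationsLogarithmsDescent
import HarnessLib

/-!
# Roy–Waldschmidt 1997: Théorème 0.2 from Théorème 0.1 (the printed deduction of §7, PROVED)

Sibling proofs file of `QuadraticRelationsLogarithms.lean` (named fact
`Literature.NumberTheory.Transcendental.royWaldschmidt_quadratic_thm_0_2` = Théorème 0.2 of
D. Roy, M. Waldschmidt, *Approximation diophantienne et indépendance algébrique de logarithmes*,
Ann. Sci. ÉNS (4) 30 (1997) 753–796).

Main result: `royWaldschmidt_quadratic_thm_0_2_of_thm_0_1` — **Théorème 0.2 follows from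
Théorème 0.1** of the same paper, the latter taken as an explicit hypothesis rendered verbatim
(p. 755): "Soit `K` un sous-corps de `ℂ` de degré de transcendance `1` sur `ℚ`, soit `M` une
matrice `d × t` à coefficients dans `𝓛_K ∩ K` et soit `n` le rang de `M`. Alors il existe un
sous-espace vectoriel `T` de `Mat_{d×t}(ℂ)`, défini sur `ℚ`, qui contient `M`, et qui consiste de
matrices de rang `≤ 2n`. De plus, si `M` possède au moins une colonne non nulle dont tous les
coefficients appartiennent à `𝓛`, alors on peut préciser que `T` consiste de matrices de rang
`< 2n`."  Here `𝓛_K = {z ∈ ℂ ; e^z ∈ K}` (p. 754) and "défini sur `ℚ`" = spanned over `ℂ` by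
rational matrices (the body of `Literature.Barriers.Schanuel.IsDefinedOverRat`, inlined).
Théorème 0.1 is itself deduced in the paper (p. 760) from Corollaire 1.4 of the main Théorème 1.1,
whose proof is §§2–6 (Waldschmidt's effective algebraic subgroup theorem, a Wirsing-type
simultaneous approximation theorem in transcendence degree `1`, Roy's categorical framework) — not
in the tree; no named fact is introduced for it here (D-0026), it stays a hypothesis.

The deduction follows §7 (p. 791 "Démonstration du théorème 0.2" and p. 795 "(iii) Démonstration
du théorème 7.1"), merged into one step by applying the Clifford construction of Lemme 7.6
directly to the quadratic form `P` instead of to `b = ∑ xᵢyᵢ ∘ θ`: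
1. reduce `deg P ≤ 2` to `deg P = 2` (`P ↦ P²` in degree `1`; a homogeneous constant vanishing at
   a point is `0`) — `exists_isHomogeneous_two`;
2. Lemme 7.6 (`RoyWaldschmidt1997.exists_matrices_sq_eq_aeval`): rational `C₁,…,Cₙ` with
   `Θ(w)² = P(w)·1` for `Θ(w) = ∑ wₖ Cₖ`; so `M = Θ(λ)` has `M² = 0`, `2·rank M ≤ D`;
3. the entries of `M` are rational combinations of the `λᵢ ∈ 𝓛`, hence in `𝓛 ∩ ℚ(λ)`
   (`isAlgebraic_cexp_sum_rat_mul`); with `K = ℚ(λ)(e^{M_{ab}})`, algebraic over `ℚ(λ)`, one has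
   `trdeg K = trdeg ℚ(λ)` (`trdeg_restrictScalars_adjoin_of_isAlgebraic`); if `trdeg ℚ(λ) = 0`,
   Hermite–Lindemann gives `λ = 0` (p. 791); if `trdeg ℚ(λ) ≥ 2` we are done; so `trdeg K = 1`;
4. Théorème 0.1 (strict form, `M ≠ 0`): `M ∈ T`, `T` defined over `ℚ`, ranks `< 2·rank M ≤ D`,
   i.e. `T` consists of singular matrices; `U = Θ⁻¹(T)` is defined over `ℚ`
   (`exists_comap_eq_ratSpan`), contains `λ`, and `P` vanishes on `U` since `P(u) ≠ 0` would make
   `Θ(u)` invertible (`rank_eq_of_mul_self_eq_smul_one`) — "U … est contenu dans W car la fonction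
   déterminant s'annule identiquement sur T" (p. 795).

## References

* [RoyWaldschmidt1997ENS] D. Roy, M. Waldschmidt, Ann. Sci. ÉNS (4) 30 (1997) 753–796:
  Théorème 0.1 and 0.2 p. 755; §7 pp. 790–795 (lit key paper:doi-10-1016-s0012-9593-97-89938-7,
  PDF pp. 4, 39–44).
-/

noncomputable section

open Complex IntermediateField MvPolynomial

namespace Literature.NumberTheory.Transcendental

namespace RoyWaldschmidt1997

variable {n : ℕ}

/-- **Reduction to degree exactly `2`.** A homogeneous `P` of degree `k ≤ 2` vanishing at `l` is
replaced by a homogeneous `P₂` of degree `2` vanishing at `l` with `Z(P₂) ⊆ Z(P)`: `P₂ = P` if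
`k = 2`, `P₂ = P²` if `k = 1`, and `P₂ = 0 = P` if `k = 0` (a constant vanishing somewhere is `0`).
[folklore] -/
theorem exists_isHomogeneous_two {k : ℕ} (P : MvPolynomial (Fin n) ℚ) (hk : k ≤ 2)
    (hP : P.IsHomogeneous k) (l : Fin n → ℂ) (hPl : aeval l P = 0) :
    ∃ P₂ : MvPolynomial (Fin n) ℚ, P₂.IsHomogeneous 2 ∧ aeval l P₂ = 0 ∧
      ∀ w : Fin n → ℂ, aeval w P₂ = 0 → aeval w P = 0 := by
  interval_cases k
  · -- `k = 0`: `P` is a constant, hence `0`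
    have hP0 : P = C (coeff 0 P) :=
      (totalDegree_eq_zero_iff_eq_C (p := P)).mp (Nat.le_zero.mp hP.totalDegree_le)
    have hc : coeff 0 P = 0 := by
      rw [hP0, aeval_C, map_eq_zero_iff _ (algebraMap ℚ ℂ).injective] at hPl
      rw [hP0, coeff_C]
      simp [hPl]
    refine ⟨0, isHomogeneous_zero _ _ 2, by simp, fun w _ => ?_⟩
    rw [hP0, hc, C_0, map_zero]
  · -- `k = 1`: `P₂ = P²`
    refine ⟨P * P, hP.mul hP, by simp [hPl], fun w hw => ?_⟩
    simpa using hw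
  · exact ⟨P, hP, hPl, fun w hw => hw⟩

end RoyWaldschmidt1997

open RoyWaldschmidt1997

/-- **Roy–Waldschmidt 1997: Théorème 0.2 follows from Théorème 0.1 (the printed deduction of §7,
PROVED).**  Hypothesis `h01` is Théorème 0.1 verbatim (p. 755): for a subfield `K ⊆ ℂ` of
transcendence degree `1` over `ℚ` and a `d × t` matrix `M` with entries in `𝓛_K ∩ K`
(`M i j ∈ K`, `e^{M i j} ∈ K`) of rank `n`, there is a subspace `T ∋ M` of `Mat_{d×t}(ℂ)` defined
over `ℚ` (spanned by rational matrices) consisting of matrices of rank `≤ 2n`; and, if some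
non-zero column of `M` has all its entries in `𝓛 = exp⁻¹(ℚ̄^×)`, such a `T` consisting of
matrices of rank `< 2n`.  Conclusion: the named fact `royWaldschmidt_quadratic_thm_0_2`
(Théorème 0.2).  Proof as printed in §7 (pp. 791, 795) through the Clifford construction of
Lemme 7.6 (`RoyWaldschmidt1997.exists_matrices_sq_eq_aeval`), the descent lemma
`RoyWaldschmidt1997.exists_comap_eq_ratSpan` and Hermite–Lindemann; see the module docstring.
Théorème 0.1 (⇐ Cor. 1.4 ⇐ Cor. 1.3 ⇐ Théorème 1.1, §§1–6 of the paper) is NOT proved in the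
tree. [cite: RoyWaldschmidt1997ENS, Théorème 0.1–0.2 p. 755; §7 pp. 791 and 795] -/
theorem royWaldschmidt_quadratic_thm_0_2_of_thm_0_1
    (h01 : ∀ (K : IntermediateField ℚ ℂ), Algebra.trdeg ℚ K = 1 →
      ∀ (d t : ℕ) (M : Matrix (Fin d) (Fin t) ℂ), (∀ i j, M i j ∈ K ∧ cexp (M i j) ∈ K) →
        (∃ T : Submodule ℂ (Matrix (Fin d) (Fin t) ℂ),
          (∃ S : Set (Matrix (Fin d) (Fin t) ℚ),
            T = Submodule.span ℂ ((fun A : Matrix (Fin d) (Fin t) ℚ => A.map (algebraMap ℚ ℂ)) '' S)) ∧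
          M ∈ T ∧ ∀ N ∈ T, N.rank ≤ 2 * M.rank) ∧
        ((∃ j, (∀ i, IsAlgebraic ℚ (cexp (M i j))) ∧ ∃ i, M i j ≠ 0) →
          ∃ T : Submodule ℂ (Matrix (Fin d) (Fin t) ℂ),
            (∃ S : Set (Matrix (Fin d) (Fin t) ℚ),
              T = Submodule.span ℂ ((fun A : Matrix (Fin d) (Fin t) ℚ => A.map (algebraMap ℚ ℂ)) '' S)) ∧
            M ∈ T ∧ ∀ N ∈ T, N.rank < 2 * M.rank)) :
    royWaldschmidt_quadratic_thm_0_2 := by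
  intro n k P hk hP l hl hPl
  obtain ⟨P₂, hP₂, hl₂, hZ⟩ := exists_isHomogeneous_two P hk hP l hPl
  suffices H : (∃ s : Set (Fin n → ℚ), l ∈ ratSpan s ∧ ∀ w ∈ ratSpan s, aeval w P₂ = 0) ∨
      (2 : Cardinal) ≤ Algebra.trdeg ℚ ↥(adjoin ℚ (Set.range l)) by
    rcases H with ⟨s, hs, hV⟩ | h2
    · exact Or.inl ⟨s, hs, fun w hw => hZ w (hV w hw)⟩
    · exact Or.inr h2
  by_cases h2 : (2 : Cardinal) ≤ Algebra.trdeg ℚ ↥(adjoin ℚ (Set.range l))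
  · exact Or.inr h2
  left
  set F : IntermediateField ℚ ℂ := adjoin ℚ (Set.range l) with hF
  -- Lemme 7.6: `Θ(w)² = P₂(w) · 1`
  obtain ⟨D, C, hD, hC⟩ := exists_matrices_sq_eq_aeval P₂ hP₂
  have hsq : ∀ w : Fin n → ℂ, (∑ k, w k • (C k).map (algebraMap ℚ ℂ)) *
      (∑ k, w k • (C k).map (algebraMap ℚ ℂ)) = aeval w P₂ • (1 : Matrix (Fin D) (Fin D) ℂ) :=
    hC ℂ
  set M : Matrix (Fin D) (Fin D) ℂ := ∑ k, l k • (C k).map (algebraMap ℚ ℂ) with hM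
  have hMM : M * M = 0 := by rw [hsq l, hl₂, zero_smul]
  have hMle : 2 * M.rank ≤ D := two_mul_rank_le_of_mul_self_eq_zero M hMM
  -- entries of `M` are rational combinations of the `λ_k`
  have hMab : ∀ a b, M a b = ∑ k, ((C k a b : ℚ) : ℂ) * l k := fun a b => by
    simp only [hM, Matrix.sum_apply, Matrix.smul_apply, Matrix.map_apply, smul_eq_mul, eq_ratCast]
    exact Finset.sum_congr rfl fun k _ => mul_comm _ _
  have hMexp : ∀ a b, IsAlgebraic ℚ (cexp (M a b)) := fun a b => by
    rw [hMab]; exact isAlgebraic_cexp_sum_rat_mul hl _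
  have hMF : ∀ a b, M a b ∈ F := fun a b => by
    rw [hMab]
    refine sum_mem fun k _ => mul_mem ?_ (subset_adjoin ℚ _ ⟨k, rfl⟩)
    exact_mod_cast (F.algebraMap_mem (C k a b) : ((algebraMap ℚ ℂ) (C k a b)) ∈ F)
  -- a subspace `T ∋ M` defined over `ℚ` consisting of singular matrices
  obtain ⟨S, hMT, hT⟩ : ∃ S : Set (Matrix (Fin D) (Fin D) ℚ),
      M ∈ Submodule.span ℂ ((fun A : Matrix (Fin D) (Fin D) ℚ => A.map (algebraMap ℚ ℂ)) '' S) ∧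
      ∀ N ∈ Submodule.span ℂ ((fun A : Matrix (Fin D) (Fin D) ℚ => A.map (algebraMap ℚ ℂ)) '' S),
        N.rank < D := by
    by_cases hM0 : M = 0
    · refine ⟨∅, by simp [hM0], fun N hN => ?_⟩
      simp only [Set.image_empty, Submodule.span_empty, Submodule.mem_bot] at hN
      rw [hN, Matrix.rank_zero]
      exact hD
    rcases trdeg_eq_zero_or_eq_one h2 with h0 | h1
    · -- `trdeg ℚ(λ) = 0`: Hermite–Lindemann forces `λ = 0`, so `M = 0`
      exfalso
      apply hM0
      have halgF : Algebra.IsAlgebraic ℚ F := trdeg_eq_zero_iff.mp h0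
      have hl0 : ∀ i, l i = 0 := fun i => by
        have hli : IsAlgebraic ℚ (⟨l i, subset_adjoin ℚ _ ⟨i, rfl⟩⟩ : F) := halgF.isAlgebraic _
        exact eq_zero_of_isAlgebraic_of_isAlgebraic_cexp (hli.algebraMap (A := ℂ)) (hl i)
      rw [hM]
      exact Finset.sum_eq_zero fun k _ => by rw [hl0 k, zero_smul]
    · -- `trdeg ℚ(λ) = 1`: Théorème 0.1 for `K = ℚ(λ)(e^{M_{ab}})`
      let E : Set ℂ := Set.range fun ab : Fin D × Fin D => cexp (M ab.1 ab.2)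
      have hE : ∀ x ∈ E, IsAlgebraic ℚ x := by
        rintro _ ⟨⟨a, b⟩, rfl⟩; exact hMexp a b
      let K : IntermediateField ℚ ℂ := (adjoin F E).restrictScalars ℚ
      have hK : Algebra.trdeg ℚ K = 1 := by
        rw [trdeg_restrictScalars_adjoin_of_isAlgebraic F hE]; exact h1
      have hMK : ∀ a b, M a b ∈ K ∧ cexp (M a b) ∈ K := fun a b => by
        constructor
        · change M a b ∈ adjoin F E
          exact (adjoin F E).algebraMap_mem ⟨M a b, hMF a b⟩
        · change cexp (M a b) ∈ adjoin F E
          exact subset_adjoin F E ⟨(a, b), rfl⟩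
      obtain ⟨-, hstrict⟩ := h01 K hK D D M hMK
      obtain ⟨a₀, b₀, hab⟩ : ∃ a b, M a b ≠ 0 := by
        by_contra! h
        exact hM0 (Matrix.ext h)
      obtain ⟨T, ⟨S, rfl⟩, hMT, hrank⟩ := hstrict ⟨b₀, fun a => hMexp a b₀, a₀, hab⟩
      exact ⟨S, hMT, fun N hN => by have := hrank N hN; omega⟩
  -- `U = Θ⁻¹(T)` is defined over `ℚ`, contains `λ`, and `P₂` vanishes on it
  obtain ⟨s, hs⟩ := exists_comap_eq_ratSpan C S
  refine ⟨s, (hs l).mp hMT, fun w hw => ?_⟩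
  have hr := hT _ ((hs w).mpr hw)
  by_contra hne
  have := rank_eq_of_mul_self_eq_smul_one _ hne (hsq w)
  omega

end Literature.NumberTheory.Transcendental
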